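import Mathlib.Analysis.Convex.Function
import Literature.MathematicalPhysics.QuantumLattice.ApproximatingHamiltonianProofs
import Literature.MathematicalPhysics.QuantumLattice.HubbardGrandCanonicalDensity
import Literature.MathematicalPhysics.QuantumLattice.DWaveSourceProofs
import Literature.MathematicalPhysics.QuantumLattice.FermionLiebRobinson

/-!
# Crux `TwSeededEnsembleEquivalenceR` (stmt-HubbardSuperconductivity-15581), line `cold-floor-collapse`
# (slug `Sketch`) — basics of the SOURCED torus pressure in the chemical potential

Support file (`--supports stmt-HubbardSuperconductivity-15581`; sorry-free; no definition; route-file free).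
For `p̃_L(β,U,μ,h) = log Re Z(β, dWaveSourceTorus L U μ h)/(βL²)` (all `L`, `β > 0`):

* `cfb_convexOn_sourcedPressure` — CONVEX in `μ` (Peierls–Bogoliubov supporting line, slope `Re⟨N̂⟩_μ/L²`);
* `cfb_abs_sourcedPressure_sub_mu_le` — `2`-Lipschitz in `μ` (`‖N̂‖ ≤ 2L²`);
* `cfb_log_partitionFn_sandwich` — the FREE SANDWICH (`U ≥ 0`, `β ≥ 0`):
  `log Z(β, S_L(0, μ − U/2, h)) ≤ log Z(β, S_L(U, μ, h)) ≤ log Z(β, S_L(0, μ, h))`, from the operator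
  inequalities `0 ≤ U Σ_x n_{x↑}n_{x↓} ≤ (U/2) N̂` and monotonicity of `log Tr e^{−βH}` (card
  cold-floor-collapse, `SourcedPressureSandwich`: the interacting sourced pressure and its densities are
  bracketed by FREE BdG ones at `μ` and `μ − U/2`);
* generic real analysis used by the line's glue: a function with a supporting line everywhere is convex;
  pointwise limits of convex functions are convex; two-point bounds pass to limits.
[folklore: Bratteli–Robinson II §5.3.1 (convexity of `log Tr e^{−β(H−μN)}`); Ruelle 1969 §3.4;
B. Simon, Statistical Mechanics of Lattice Gases I §II.]
-/

set_option linter.dupNamespace false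

namespace Summit.HubbardSuperconductivity.HubbardSuperconductivity.Theorems.TwSeededEnsembleEquivalenceR.ColdFloorLine

open Matrix Finset Literature.MathematicalPhysics.QuantumLattice
open scoped ComplexOrder Matrix.Norms.L2Operator

noncomputable section

/-! ### Generic real analysis -/

/-- A real function with a supporting line at every point is convex on `ℝ`. [folklore] -/
theorem cfb_convexOn_univ_of_supportingLine {f : ℝ → ℝ}
    (hf : ∀ x : ℝ, ∃ s : ℝ, ∀ y : ℝ, f x + s * (y - x) ≤ f y) : ConvexOn ℝ Set.univ f := by
  refine ⟨convex_univ, fun x _ y _ a b ha hb hab => ?_⟩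
  obtain rfl : b = 1 - a := by linarith
  set w : ℝ := a • x + (1 - a) • y with hw
  obtain ⟨s, hs⟩ := hf w
  have h1 := hs x
  have h2 := hs y
  have key := add_le_add (mul_le_mul_of_nonneg_left h1 ha) (mul_le_mul_of_nonneg_left h2 hb)
  have e : a * (f w + s * (x - w)) + (1 - a) * (f w + s * (y - w)) = f w := by
    simp only [hw, smul_eq_mul]; ring
  rw [e] at key
  simpa [smul_eq_mul] using key

/-- A pointwise limit (along `ℕ`, `ε`–`N` form) of convex functions on `ℝ` is convex. [folklore:
Rockafellar, Convex Analysis, Thm 10.8] -/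
theorem cfb_convexOn_univ_of_limit {f : ℕ → ℝ → ℝ} {F : ℝ → ℝ}
    (hf : ∀ n, ConvexOn ℝ Set.univ (f n))
    (hlim : ∀ x : ℝ, ∀ κ : ℝ, 0 < κ → ∃ N : ℕ, ∀ n, N ≤ n → |f n x - F x| ≤ κ) :
    ConvexOn ℝ Set.univ F := by
  refine ⟨convex_univ, fun x _ y _ a b ha hb hab => ?_⟩
  apply le_of_forall_pos_lt_add
  intro ε hε
  obtain ⟨N₁, hN₁⟩ := hlim (a • x + b • y) (ε / 4) (by positivity)
  obtain ⟨N₂, hN₂⟩ := hlim x (ε / 4) (by positivity)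
  obtain ⟨N₃, hN₃⟩ := hlim y (ε / 4) (by positivity)
  set n := max N₁ (max N₂ N₃) with hn
  have h1 := hN₁ n (le_max_left _ _)
  have h2 := hN₂ n ((le_max_left _ _).trans (le_max_right _ _))
  have h3 := hN₃ n ((le_max_right _ _).trans (le_max_right _ _))
  have hc := (hf n).2 (Set.mem_univ x) (Set.mem_univ y) ha hb hab
  rw [abs_le] at h1 h2 h3
  simp only [smul_eq_mul] at hc h1 ⊢
  have ha' : a * f n x ≤ a * (F x + ε / 4) := mul_le_mul_of_nonneg_left (by linarith) ha
  have hb' : b * f n y ≤ b * (F y + ε / 4) := mul_le_mul_of_nonneg_left (by linarith) hb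
  nlinarith [h1.1, h1.2, ha', hb', hc, hab]

/-- Two-point bounds pass to pointwise limits: if `uₙ → A`, `vₙ → B` (`ε`–`N` form) and
`|uₙ − vₙ| ≤ C` for all `n`, then `|A − B| ≤ C`. [folklore] -/
theorem cfb_abs_sub_le_of_limits {u v : ℕ → ℝ} {A B C : ℝ}
    (hu : ∀ κ : ℝ, 0 < κ → ∃ N : ℕ, ∀ n, N ≤ n → |u n - A| ≤ κ)
    (hv : ∀ κ : ℝ, 0 < κ → ∃ N : ℕ, ∀ n, N ≤ n → |v n - B| ≤ κ)
    (huv : ∀ n, |u n - v n| ≤ C) : |A - B| ≤ C := by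
  apply le_of_forall_pos_lt_add
  intro ε hε
  obtain ⟨N₁, hN₁⟩ := hu (ε / 4) (by positivity)
  obtain ⟨N₂, hN₂⟩ := hv (ε / 4) (by positivity)
  have h1 := hN₁ (max N₁ N₂) (le_max_left _ _)
  have h2 := hN₂ (max N₁ N₂) (le_max_right _ _)
  have h3 := huv (max N₁ N₂)
  rw [abs_le] at h1 h2 h3
  rw [abs_lt]
  constructor <;> linarith

/-- One-sided bounds pass to pointwise limits: if `uₙ → A`, `vₙ → B` and `uₙ ≤ vₙ` for all `n`, then
`A ≤ B`. [folklore] -/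
theorem cfb_le_of_limits {u v : ℕ → ℝ} {A B : ℝ}
    (hu : ∀ κ : ℝ, 0 < κ → ∃ N : ℕ, ∀ n, N ≤ n → |u n - A| ≤ κ)
    (hv : ∀ κ : ℝ, 0 < κ → ∃ N : ℕ, ∀ n, N ≤ n → |v n - B| ≤ κ)
    (huv : ∀ n, u n ≤ v n) : A ≤ B := by
  apply le_of_forall_pos_lt_add
  intro ε hε
  obtain ⟨N₁, hN₁⟩ := hu (ε / 4) (by positivity)
  obtain ⟨N₂, hN₂⟩ := hv (ε / 4) (by positivity)
  have h1 := hN₁ (max N₁ N₂) (le_max_left _ _)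
  have h2 := hN₂ (max N₁ N₂) (le_max_right _ _)
  have h3 := huv (max N₁ N₂)
  rw [abs_le] at h1 h2
  linarith

/-! ### The sourced torus pressure in `μ` -/

section Sourced

variable (L : ℕ) [NeZero L]

omit [NeZero L] in
/-- `‖N̂‖ ≤ 2L²` on the torus of side `L`. [folklore] -/
theorem cfb_norm_totalNumber_le :
    ‖(totalNumber : Matrix (Finset (Orb (FermionTorus 2 L))) (Finset (Orb (FermionTorus 2 L))) ℂ)‖ ≤
      2 * (L : ℝ) ^ 2 := by
  rw [totalNumber]
  refine (norm_sum_le _ _).trans ?_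
  calc ∑ x : FermionTorus 2 L, ‖∑ σ : Fin 2, (numberOp x σ : Matrix (Finset (Orb (FermionTorus 2 L))) _ ℂ)‖
      ≤ ∑ _x : FermionTorus 2 L, (2 : ℝ) := Finset.sum_le_sum fun x _ => by
        refine (norm_sum_le _ _).trans ?_
        calc ∑ σ : Fin 2, ‖(numberOp x σ : Matrix (Finset (Orb (FermionTorus 2 L))) _ ℂ)‖
            ≤ ∑ _σ : Fin 2, (1 : ℝ) := Finset.sum_le_sum fun σ _ => norm_numberOp_le_one x σ
          _ = 2 := by simp
    _ = 2 * (L : ℝ) ^ 2 := by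
        rw [Finset.sum_const, Finset.card_univ, card_fermionTorus, nsmul_eq_mul]
        push_cast; ring

/-- `H_L(μ) − H_L(μ') = (μ' − μ) N̂` for the sourced torus Hamiltonians. [folklore] -/
theorem cfb_dWaveSourceTorus_sub_mu (U μ μ' h : ℝ) :
    dWaveSourceTorus L U μ h - dWaveSourceTorus L U μ' h = ((μ' - μ : ℝ) : ℂ) • totalNumber := by
  simp only [dWaveSourceTorus, hubbardTorusWith_eq]
  push_cast
  rw [sub_smul]
  abel

/-- **The sourced pressure is `2`-Lipschitz in `μ`**: `|p̃_L(β,U,μ,h) − p̃_L(β,U,μ',h)| ≤ 2|μ − μ'|`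
(`β > 0`; `|log Z(H₁) − log Z(H₂)| ≤ β‖H₁ − H₂‖`, `‖N̂‖ ≤ 2L²`). [folklore] -/
theorem cfb_abs_sourcedPressure_sub_mu_le (U h : ℝ) {β : ℝ} (hβ : 0 < β) (μ μ' : ℝ) :
    |Real.log (partitionFn β (dWaveSourceTorus L U μ h)).re / (β * (L : ℝ) ^ 2) -
        Real.log (partitionFn β (dWaveSourceTorus L U μ' h)).re / (β * (L : ℝ) ^ 2)| ≤
      2 * |μ - μ'| := by
  have hL := cast_sq_pos_of_neZero L
  have hβL : 0 < β * (L : ℝ) ^ 2 := mul_pos hβ hL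
  rw [← sub_div, abs_div, abs_of_pos hβL, div_le_iff₀ hβL]
  have key := abs_log_partitionFn_sub_log_partitionFn_le
    (dWaveSourceTorus_isHermitian L (isHermitian_hubbardTorusWith L 1 U μ) h)
    (dWaveSourceTorus_isHermitian L (isHermitian_hubbardTorusWith L 1 U μ') h) hβ.le
  refine key.trans ?_
  rw [cfb_dWaveSourceTorus_sub_mu, norm_smul, Complex.norm_real, Real.norm_eq_abs, abs_sub_comm]
  have hn := cfb_norm_totalNumber_le L
  calc β * (|μ - μ'| * ‖(totalNumber : Matrix (Finset (Orb (FermionTorus 2 L))) _ ℂ)‖)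
      ≤ β * (|μ - μ'| * (2 * (L : ℝ) ^ 2)) := by gcongr
    _ = 2 * |μ - μ'| * (β * (L : ℝ) ^ 2) := by ring

/-- **The sourced pressure is convex in `μ`** (Peierls–Bogoliubov: `log Z(H(μ')) ≥ log Z(H(μ)) −
β Re⟨H(μ') − H(μ)⟩_{H(μ)}`, a supporting line of slope `Re⟨N̂⟩_{μ}/L²`). [folklore: Bratteli–Robinson II
§5.3.1; Ruelle 1969 §3.4] -/
theorem cfb_convexOn_sourcedPressure (U h : ℝ) {β : ℝ} (hβ : 0 < β) :
    ConvexOn ℝ Set.univ (fun μ : ℝ =>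
      Real.log (partitionFn β (dWaveSourceTorus L U μ h)).re / (β * (L : ℝ) ^ 2)) := by
  have hL := cast_sq_pos_of_neZero L
  have hL0 : (L : ℝ) ≠ 0 := fun h0 => by rw [h0] at hL; simp at hL
  have hβL : 0 < β * (L : ℝ) ^ 2 := mul_pos hβ hL
  apply cfb_convexOn_univ_of_supportingLine
  intro μ
  refine ⟨(gibbsState β (dWaveSourceTorus L U μ h) totalNumber).re / (L : ℝ) ^ 2, fun μ' => ?_⟩
  have hH := dWaveSourceTorus_isHermitian L (isHermitian_hubbardTorusWith L 1 U μ) h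
  have hW : (dWaveSourceTorus L U μ' h - dWaveSourceTorus L U μ h).IsHermitian :=
    (dWaveSourceTorus_isHermitian L (isHermitian_hubbardTorusWith L 1 U μ') h).sub hH
  have pb := log_partitionFn_sub_le_log_partitionFn_add hH hW β
  rw [add_sub_cancel, cfb_dWaveSourceTorus_sub_mu, map_smul, smul_eq_mul, Complex.re_ofReal_mul] at pb
  rw [div_add' _ _ _ hβL.ne', div_le_div_iff_of_pos_right hβL]
  have : (gibbsState β (dWaveSourceTorus L U μ h) totalNumber).re / (L : ℝ) ^ 2 * (μ' - μ) *
      (β * (L : ℝ) ^ 2) = β * ((μ' - μ) * (gibbsState β (dWaveSourceTorus L U μ h) totalNumber).re) := by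
    field_simp
  nlinarith [pb, this]

end Sourced

section HalfNumber

variable {Λ : Type*} [LinearOrder Λ] [Fintype Λ]

/-- `Σ_x n_{x↑} n_{x↓} ≤ ½ N̂` as operators (a doubly occupied site carries two particles; any finite
lattice). [folklore] -/
theorem cfb_posSemidef_half_totalNumber_sub_doubleOcc :
    (((1 / 2 : ℝ) : ℂ) • (totalNumber : Matrix (Finset (Orb Λ)) (Finset (Orb Λ)) ℂ) -
      ∑ x : Λ, numberOp x 0 * numberOp x 1).PosSemidef := by
  rw [sum_numberOp_mul_numberOp_eq_diagonal, totalNumber_eq_diagonal_card, ← diagonal_smul, diagonal_sub,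
    posSemidef_diagonal_iff]
  intro s
  simp only [Pi.smul_apply, smul_eq_mul]
  have h2 : 2 * (doublyOccupied s).card ≤ s.card := by
    rw [card_eq_upPart_add_downPart s, doublyOccupied, two_mul]
    exact add_le_add (Finset.card_le_card Finset.inter_subset_left)
      (Finset.card_le_card Finset.inter_subset_right)
  have h2' : (2 : ℝ) * (doublyOccupied s).card ≤ s.card := by exact_mod_cast h2
  have : (0 : ℝ) ≤ 1 / 2 * (s.card : ℝ) - (doublyOccupied s).card := by linarith
  have hc : ((1 / 2 : ℝ) : ℂ) * (s.card : ℂ) - ((doublyOccupied s).card : ℂ) =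
      ((1 / 2 * (s.card : ℝ) - (doublyOccupied s).card : ℝ) : ℂ) := by push_cast; ring
  rw [hc]
  exact Complex.zero_le_real.2 this

end HalfNumber

section Sandwich

variable (L : ℕ) [NeZero L]

/-- **The free sandwich** (`U ≥ 0`, `β ≥ 0`): `log Z(β, S_L(0, μ − U/2, h)) ≤ log Z(β, S_L(U, μ, h)) ≤
log Z(β, S_L(0, μ, h))` for the sourced torus `S_L(U, μ, h) = dWaveSourceTorus L U μ h`, from
`0 ≤ U Σ n↑n↓ ≤ (U/2) N̂` and `H₁ ≤ H₂ ⇒ log Z(H₂) ≤ log Z(H₁)`. [folklore] -/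
theorem cfb_log_partitionFn_sandwich {U β : ℝ} (hU : 0 ≤ U) (hβ : 0 ≤ β) (μ h : ℝ) :
    Real.log (partitionFn β (dWaveSourceTorus L 0 (μ - U / 2) h)).re ≤
        Real.log (partitionFn β (dWaveSourceTorus L U μ h)).re ∧
      Real.log (partitionFn β (dWaveSourceTorus L U μ h)).re ≤
        Real.log (partitionFn β (dWaveSourceTorus L 0 μ h)).re := by
  have hHU := dWaveSourceTorus_isHermitian L (isHermitian_hubbardTorusWith L 1 U μ) h
  have hH0 := dWaveSourceTorus_isHermitian L (isHermitian_hubbardTorusWith L 1 0 μ) h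
  have hH0' := dWaveSourceTorus_isHermitian L (isHermitian_hubbardTorusWith L 1 0 (μ - U / 2)) h
  constructor
  · -- `S_L(0, μ − U/2) − S_L(U, μ) = U (½N̂ − Σ n↑n↓) ≥ 0`
    refine log_partitionFn_le_of_posSemidef hHU hH0' hβ ?_
    have e : dWaveSourceTorus L 0 (μ - U / 2) h - dWaveSourceTorus L U μ h =
        (U : ℂ) • ((((1 / 2 : ℝ) : ℂ) • (totalNumber : Matrix (Finset (Orb (FermionTorus 2 L))) _ ℂ)) -
          ∑ x : FermionTorus 2 L, numberOp x 0 * numberOp x 1) := by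
      have h1 := cfb_dWaveSourceTorus_sub_mu L 0 (μ - U / 2) μ h
      have h2 : dWaveSourceTorus L U μ h - dWaveSourceTorus L 0 μ h =
          (U : ℂ) • ∑ x : FermionTorus 2 L, numberOp x 0 * numberOp x 1 := by
        simp only [dWaveSourceTorus, sub_sub_sub_cancel_right]
        have := hamiltonianWith_sub_hamiltonianWith (fermionTorusGraph 2 L) 1 0 U μ
        rw [sub_zero] at this
        exact this
      have : dWaveSourceTorus L 0 (μ - U / 2) h - dWaveSourceTorus L U μ h =
          (dWaveSourceTorus L 0 (μ - U / 2) h - dWaveSourceTorus L 0 μ h) -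
            (dWaveSourceTorus L U μ h - dWaveSourceTorus L 0 μ h) := by abel
      rw [this, h1, h2, smul_sub, smul_smul]
      congr 2
      push_cast; ring
    rw [e]
    exact (cfb_posSemidef_half_totalNumber_sub_doubleOcc (Λ := FermionTorus 2 L)).smul
      (Complex.zero_le_real.2 hU)
  · -- `S_L(U, μ) − S_L(0, μ) = U Σ n↑n↓ ≥ 0`
    refine log_partitionFn_le_of_posSemidef hH0 hHU hβ ?_
    have h2 : dWaveSourceTorus L U μ h - dWaveSourceTorus L 0 μ h =
        (U : ℂ) • ∑ x : FermionTorus 2 L, numberOp x 0 * numberOp x 1 := by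
      simp only [dWaveSourceTorus, sub_sub_sub_cancel_right]
      have := hamiltonianWith_sub_hamiltonianWith (fermionTorusGraph 2 L) 1 0 U μ
      rw [sub_zero] at this
      exact this
    rw [h2]
    exact (posSemidef_sum_numberOp_mul_numberOp (Λ := FermionTorus 2 L)).smul (Complex.zero_le_real.2 hU)

/-- **Registered stub `stub_sourcedPressureSandwich` (line `Sketch`, crux stmt-HubbardSuperconductivity-15581):
the free sandwich in binder-free form** — card cold-floor-collapse's `SourcedPressureSandwich`. [folklore] -/
theorem stub_sourcedPressureSandwich : ∀ (L : ℕ) [NeZero L] (U β μ h : ℝ), 0 ≤ U → 0 ≤ β → Real.log (Matrix.partitionFn β (dWaveSourceTorus L 0 (μ - U / 2) h)).re ≤ Real.log (Matrix.partitionFn β (dWaveSourceTorus L U μ h)).re ∧ Real.log (Matrix.partitionFn β (dWaveSourceTorus L U μ h)).re ≤ Real.log (Matrix.partitionFn β (dWaveSourceTorus L 0 μ h)).re :=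
  fun L _ _ _ μ h hU hβ => cfb_log_partitionFn_sandwich L hU hβ μ h

end Sandwich

end

end Summit.HubbardSuperconductivity.HubbardSuperconductivity.Theorems.TwSeededEnsembleEquivalenceR.ColdFloorLine
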